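import Literature.MathematicalPhysics.QuantumFieldTheory.Balaban1983to89.B6RandomWalkInputNormChain
import Literature.MathematicalPhysics.QuantumFieldTheory.Balaban1983to89.B6Grad2NormSuppLegKLevelV1
import Literature.MathematicalPhysics.QuantumFieldTheory.Balaban1983to89.B6Prop26KLevelSkeletonV2
import Literature.MathematicalPhysics.QuantumFieldTheory.Balaban1983to89.B6Prop26GradKLevelV1
import Literature.MathematicalPhysics.QuantumFieldTheory.Balaban1983to89.B6Prop26DivLegKLevelV1
import Literature.MathematicalPhysics.QuantumFieldTheory.Balaban1983to89.B6CubeMoutV1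
import Literature.MathematicalPhysics.QuantumFieldTheory.Balaban1983to89.B6Cover236QbigOverlapV1
import Literature.MathematicalPhysics.QuantumFieldTheory.Balaban1983to89.B6Prop26Census2136KLevelV1
import Literature.MathematicalPhysics.QuantumFieldTheory.Balaban1983to89.B6HolderNormV1

/-!
# `Balaban1983to89.B6Ineq2138KLevelSkeletonV1` — T. Bałaban, *Propagators and renormalization transformations for lattice gauge theories. II*,
# Commun. Math. Phys. **96** (1984) 223–250 [Balaban1984PropagatorsII], Prop. 2.6 (2.138) p. 247
# `|(∇G∇*J)(x)| ≤ O(1)e^{−δ₃d(y,y′)}(‖J‖^{ξ′}_ε + |J|)` AT k LEVELS FOR THE GENUINE `G = Δ_a⁻¹` ON THE V1 TORUS — THE WALK (2.141) ASSEMBLED IN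
# PRINT'S SERIES ORDER `∇G∇* = ∇G₀∇* + (∇G)·(R∇*)`, GIVEN the last legs `K_{□,□′}G_{□′}h_{□′}∇*_ν` on Hölder inputs (one displayed family), and the
# census slot `c3` of `B6Prop26PrintedStage2KLevelV1.prop26Printed_kLevel_of_slots5` READ OFF it

statement-level skeleton of published theorems with citation tags; proofs where landed; nothing here is a claim about the Yang–Mills mass gap

WHAT IS PRINTED (p. 247 [PDF 25]): *"|(∇G∇*J)(x)| ≤ O(1)e^{−δ₃d(y,y′)}(‖J‖^{ξ′}_ε + |J|) (2.138) for 0 < ε < 1, x ∈ Δ(y), supp J ⊂ Δ̃(y′), y′ ∈ Λ_{j′},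
ξ′ = L^{−j′}, with the constant O(1) depending on d, L, and ε (O(1) → ∞ if ε → 0) … The operator G can be represented as G = G₀(I − R)⁻¹ = Σ_{n=0}^∞ G₀Rⁿ
= Σ_ω h_{□₀}G_{□₀}h_{□₀}K_{□₁,□₂}G_{□₂}h_{□₂}…K_{□_{2n−1},□_{2n}}G_{□_{2n}}h_{□_{2n}}, (2.141) and the series above is convergent in the norms appearing in
the inequalities (2.136)–(2.140)."*; p. 239 [PDF 17]: *"G₀ = Σ_□ h_□G_□h_□ … Δ_aG₀ = I − Σ K_{□,□′}G_{□′}h_{□′} = I − R (2.91)"*.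

CITATION HEADER (lean-in-tree rule) — WHAT IS REPRODUCED.  Cell `pub-ymgap`, seat `pub-ymgap-dag-n03-b` (FIRST-MISSING-ESTIMATE for DAG node N03 = [B6];
the census slot `c3` of `…B6Prop26PrintedStage2KLevelV1.prop26Printed_kLevel_of_slots5` is the first estimate of N03's leaf with no tree producer).  THE
READING (print: *"Reasoning in the same way as in the proof of Proposition 2.2"*): in the series order of (2.141), `∇_μG∇*_ν = ∇_μG₀∇*_ν + (∇_μG)·(R∇*_ν)`
(`…B6RandomWalkInputNormChain.conj_fixedPoint` on the tree's fixed point `G = G₀ + GR` of the genuine k-level family, `…B6Prop26.fixedPoint_of_291` with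
`…B6Eq291Generator.eq291`), every two-difference object sits on the INPUT side (the Hölder norm of `J` enters only through the last legs), and
`…B6RandomWalkInputNormChain.prop26_chain_2138With` closes with Lemma 2.1 (2.63) at any constant.  THIS FILE:
* §1 elementary side facts (the right factor `h_{□′}∇*_ν` kills the admissible inputs localised off `□′⁺`; the Lemma-2.1 budget; the transport condition);
* §2 **`gradGZeroDiv_normSupp`** — the `n = 0` term `∇_μG₀∇*_ν = Σ_□ ∇_μ(h_□G_□h_□)∇*_ν` on the census Hölder class from p27's per-cube leg
  `…B6Grad2NormSuppLegKLevelV1.hD2hGh0_cube` glued over the reaches (`…hasMajorantA_sum_overlap`, overlap `3·9^{d+1}` of the `□̃`);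
* §3 **`ineq2138_kLevel_skeleton`** — for the weight band there is `σ₀ > 0` and, for every `0 < ε < 1` and rate `0 < σ ≤ σ₀`, constants `A, M₂` with: on every
  admissible V1 torus (`k ≥ 2`, `M_h = Lᵃ ≥ 8`, `R ≥ 2L²`, `P′ ≥ 5`, `L ≥ 5`, cubes placed, `M₂ ≤ L·M_h`), for `c′ ≠ 0`, positive weights in the global band,
  directions `μ, ν`, GIVEN the last legs `K_{□,□′}G_{□′}h_{□′}∇*_ν` of every pair of cubes on the Hölder class with the majorant
  `θ·(|c′|/L^{j(y′)})·e^{−σ d_T(y,y′)}` (ONE displayed family, `θ ≥ 0` free — no smallness is needed: it was spent in (2.136)₂):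
  `HasMajorantA (NormSupp (blkV1) {y′} (‖·‖_ε + |·|)) (∇_μG∇*_ν) (A·(1 + θ)·e^{−(σ/8) d_T(y,y′)})` — print's (2.138) with `δ₃ = σ/8`;
* §4 **`ineq2138_kLevel_census_of_legs`** — the census slot `c3` (r03's shape VERBATIM: `(kG i).e4 J y ≤ Cε ε·e^{−δ₃ d}·(‖J‖_ε + |J|)`) from the same
  displayed family stated uniformly on the index `KIdx`.
Inputs BY NAME: S = `∇_μG` — `…B6Prop26GradKLevelV1.prop26_2136_grad_kLevel_unconditional` ((2.136)₂ hypothesis-free); T₀ — §2; Lemma 2.1 —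
`…B6Geom246MultiLevelTorus.lemma21_torus`; the genuine (2.91) family — `…B6CubeWindowV1` (`Gl/Ml/Pl`, `hagree_cube`, `hinvl_cube`), `…B6Prop26KLevelSkeletonV1`
(`hB`, `zB`, `ST`), `…B6Prop26KLevelSkeletonV2` (`SbigT`, `outLoc_kFam_big`), `…B6CubeMoutV1.outLoc_Ml_hB'`, `…B6Cover236QbigOverlapV1.card_filter_mem_QbigT_le`;
the transport of the block prefactors — `…B6Prop26DivLegKLevelV1.len_le_of_levelGap`; the census reading — `…B6HolderNormV1.abs_apply_le_of_suppIn`,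
`…B6Prop26Census2136KLevelV1` (`kG`, `supIn_le`).  THEOREMS ONLY (no `def`, no `def … : Prop`, no new hypothesis-shaped fact); standard axioms.

HONEST SCOPE / DIVERGENCES.  (1) ONE displayed input remains: the last legs `K_{□,□′}G_{□′}h_{□′}∇*_ν` on Hölder inputs (print's (2.134) read *"in the
norms appearing in (2.138)"*; the Hölder norm of `J` enters through the member (1.112) of [Balaban1984PropagatorsI] inside the line-1 term of (2.92)) —
the subject of the sequel files of this seat; every other input is a tree theorem by name.  (2) `supp J ⊂ Δ(y′)` (one block; print: `Δ̃(y′)`) as in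
r03's census (GAPS G-B6-2138-SUPP).  (3) Constants on `d, L, b₀, b₁, ε, σ` only — NOT on `k, M_h, m, K, c′`; print's rate `δ₃(d, L)` is our `σ/8`.
(4) `L ≥ 5`, `M_h = Lᵃ ≥ 8`, `R ≥ 2L²`, `P′ ≥ 5`, `k ≥ 2`, cubes placed (the V1 family of ROUTE V/W).  Integer torus, lattice units; nothing on d = 4 or
the continuum; NOT a node discharge; NOT summit progress.  Unit `pub-ymgap-dag-n03-b` (gen 0), 2026-08-25.
-/

open scoped BigOperators
open Finset

namespace Literature.MathematicalPhysics.QuantumFieldTheory.Balaban1983to89.B6Ineq2138KLevelSkeletonV1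

open LatticeFieldCalculus
open B6MultiLevelBoxOperator (N0)
open B6MultiLevelTorusOperator (TDomains)
open B6Cover236MultiLevelBlocks (cubes)
open B6Geom246MultiLevelTorus (geomT lemma21_torus triangle_refl_nonneg_T)
open B8Ineq192MultiLevelTorus (geomTB geomTB_len geomT_len symmT)
open B6RandomWalk (HasMajorant hasMajorant_mono delta3 Triangle254)
open B6RandomWalkInputNorm (HasMajorantA NormSupp hasMajorantA_mono hasMajorantA_add normSupp_nonneg)
open B6RandomWalkInputNormChain (hasMajorantA_localise hasMajorantA_sum_overlap hasMajorantA_sum_pairs_overlap conj_fixedPoint prop26_chain_2138With)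
open B6Prop26Gluing (mulOp mulOp_apply OutLoc outLoc_mul ind ind_nonneg ind_le_one ind_of_mem ind_of_not_mem)
open B6Prop26 (fixedPoint_of_291)
open B6Ineq261LevelGap (K261 K261_nonneg)
open B6Lemma21Repaired (Ineq261With Ineq263With)
open B6Eq291Generator (kFam gZero rOp eq291)
open B6Ineq2133TwoScaleV1 (onFun)
open B6GlobalChartV1 (PV toBox domT blkV1)
open B6AgreeLapV1Chart (deltaAE_split)
open B6SectAOperatorsV1 (dE dsE dcE dcsE QE aE QsE RE BondIdx)
open B6SectAVectorModelV1 (GE deltaAE)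
open B6GradLegKLevelV1 (DV blkV1_mem_ST_of_hB_shift_ne_zero)
open B6LapLegKLevelV1 (DVa DVa_apply)
open B6Partition118KLevelTorusCentral (QT QbigT one_le_of_four_le)
open B6Prop26KLevelSkeletonV1 (hB zB ST mem_ST pref pref_nonneg abs_hB_le_one blkV1_mem_QT_of_hB_ne_zero mulOp_zB_mul_hB mulOp_hB_mul_zB sum_mulOp_hB_sq
  onFun_GE_mul_deltaAE)
open B6Prop26KLevelSkeletonV2 (SbigT mem_SbigT ST_subset_SbigT hNov_SbigT_of_QbigT blkV1_mem_SbigT_of_hB_ne_zero outLoc_kFam_big)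
open B6CubeWindowV1 (Placed Gl Ml Pl GlobalBand hagree_cube hinvl_cube band_of_global band_le one_le_of_eight_le four_le_of_five_le)
open B6CubeMoutV1 (outLoc_Ml_hB')
open B6Cover236QbigOverlapV1 (card_filter_mem_QbigT_le)
open B6Prop26KLevelAssemblyV1 (distT_nonneg lenTB_pos)
open B6Prop26GradKLevelV1 (prop26_2136_grad_kLevel_unconditional)
open B6Prop26DivLegKLevelV1 (len_le_of_levelGap)
open B6Grad2NormSuppLegKLevelV1 (hD2hGh0_cube)
open B6HolderNormV1 (holderV1 supNormV1 holderV1_nonneg supNormV1_nonneg abs_apply_le_of_suppIn)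
open B6KLevelCensusIndexV1 (KIdx kGeoG lenG_eq_geomT)
open B6Prop26Census2136KLevelV1 (kG Gop supIn supIn_le)

noncomputable section

variable {d ℓ : ℕ} {hd : 1 ≤ d + 1} {hL : Odd (ℓ + 1) ∧ 1 < ℓ + 1} {m K : ℕ} {Mh k R : ℕ} {P' : Fin (d + 1) → ℕ}

/-! ## §1  Side facts -/

section Side

/-- an exponential kernel with a smaller rate dominates. [cite: Balaban1984PropagatorsII, (2.138) p.247, bookkeeping] -/
private theorem exp_le_exp_of_rate {ρ σ t : ℝ} (h : σ ≤ ρ) (ht : 0 ≤ t) : Real.exp (-(ρ * t)) ≤ Real.exp (-(σ * t)) :=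
  Real.exp_le_exp.mpr (neg_le_neg (mul_le_mul_of_nonneg_right h ht))

/-- the budget inequality `e^{−ασ}·L^{2(d+1)/N₀} < 1` for `N₀ := ⌈2(d+1)·log L/(ασ)⌉₊ + 1` (`α, σ > 0`); the private helper of
`…B6Prop26LapKLevelV1`, re-proved. [folklore] -/
private theorem budget_lt_one {d ℓ : ℕ} {α σ : ℝ} (hα : 0 < α) (hσ : 0 < σ) :
    Real.exp (-(α * σ)) * ((ℓ : ℝ) + 1) ^ ((2 * (d + 1 : ℕ) : ℝ) / (⌈2 * ((d : ℝ) + 1) * Real.log ((ℓ : ℝ) + 1) / (α * σ)⌉₊ + 1 : ℕ)) < 1 := by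
  have hL : (0 : ℝ) < (ℓ : ℝ) + 1 := by positivity
  have hlog : 0 ≤ Real.log ((ℓ : ℝ) + 1) := Real.log_nonneg (by linarith [(Nat.cast_nonneg ℓ : (0 : ℝ) ≤ ℓ)])
  have hN : 2 * ((d : ℝ) + 1) * Real.log ((ℓ : ℝ) + 1) / (α * σ) <
      ((⌈2 * ((d : ℝ) + 1) * Real.log ((ℓ : ℝ) + 1) / (α * σ)⌉₊ + 1 : ℕ) : ℝ) := by
    push_cast
    exact lt_of_le_of_lt (Nat.le_ceil _) (lt_add_one _)
  have hNpos : (0 : ℝ) < ((⌈2 * ((d : ℝ) + 1) * Real.log ((ℓ : ℝ) + 1) / (α * σ)⌉₊ + 1 : ℕ) : ℝ) := by positivity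
  have hασ : 0 < α * σ := mul_pos hα hσ
  have key : (2 * (d + 1 : ℕ) : ℝ) / (⌈2 * ((d : ℝ) + 1) * Real.log ((ℓ : ℝ) + 1) / (α * σ)⌉₊ + 1 : ℕ) * Real.log ((ℓ : ℝ) + 1) < α * σ := by
    rw [div_mul_eq_mul_div, div_lt_iff₀ hNpos]
    rw [div_lt_iff₀ hασ] at hN
    push_cast at hN ⊢
    nlinarith
  rw [Real.rpow_def_of_pos hL, ← Real.exp_add, Real.exp_lt_one_iff]
  nlinarith

/-- the transport condition `2 log L ≤ τ·(R·L·M_h − 1)` from `⌈2 log L/τ⌉₊ + 1 ≤ R·L·M_h` (`τ > 0`). [folklore] -/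
private theorem transport_of_le {ℓ Mh R : ℕ} {τ : ℝ} (hτ : 0 < τ)
    (hRM : ⌈2 * Real.log ((ℓ : ℝ) + 1) / τ⌉₊ + 1 ≤ R * ((ℓ + 1) * Mh)) : 2 * Real.log ((ℓ : ℝ) + 1) ≤ τ * (((R * ((ℓ + 1) * Mh) - 1 : ℕ)) : ℝ) := by
  have h1 : 2 * Real.log ((ℓ : ℝ) + 1) / τ ≤ (⌈2 * Real.log ((ℓ : ℝ) + 1) / τ⌉₊ : ℝ) := Nat.le_ceil _
  have h2 : ((⌈2 * Real.log ((ℓ : ℝ) + 1) / τ⌉₊ : ℕ) : ℝ) ≤ (((R * ((ℓ + 1) * Mh) - 1 : ℕ)) : ℝ) := by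
    exact_mod_cast (by omega : ⌈2 * Real.log ((ℓ : ℝ) + 1) / τ⌉₊ ≤ R * ((ℓ + 1) * Mh) - 1)
  rw [div_le_iff₀ hτ] at h1
  nlinarith

/-- a natural threshold below `L·M_h` from a real one: `N ≤ M₂ ≤ L·M_h` gives `N ≤ R·(L·M_h)` for `R ≥ 1`. [folklore] -/
private theorem nat_le_RLM {ℓ Mh R N : ℕ} {M₂ : ℝ} (hN : (N : ℝ) ≤ M₂) (hM : M₂ ≤ ((ℓ : ℝ) + 1) * Mh) (hR : 1 ≤ R) :
    N ≤ R * ((ℓ + 1) * Mh) := by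
  have h1 : (N : ℝ) ≤ (((ℓ + 1) * Mh : ℕ) : ℝ) := by push_cast; exact hN.trans hM
  have h2 : N ≤ (ℓ + 1) * Mh := by exact_mod_cast h1
  exact h2.trans (Nat.le_mul_of_pos_left _ hR)

variable (hN : ∀ μ, N0 ℓ Mh k P' μ = (PV d ℓ m K hd hL).sitesPerDir 0) (D : TDomains d ℓ Mh k P' R)

/-- **THE RIGHT FACTOR `h_{□′}·∇*_ν` KILLS THE ADMISSIBLE INPUTS LOCALISED OFF `□′⁺`**: an input supported on the block `y′` with `y′ ∉ Q^T_{□′}` is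
annihilated by `T·h_{□′}·∇*_ν` (`∇*_ν` reads `J` at `x` and `x − e_ν`; `h_{□′}(x) ≠ 0` puts both blocks in `□′⁺` — `M_h ≥ 8`, `R ≥ 2L`, `P′ ≥ 5`).
[cite: Balaban1984PropagatorsII, (2.91) p.239 (the right cut-off `h_{□′}`), (2.141) p.247, p.235] -/
theorem inKill_hB_DVa {hMh1 : 1 ≤ Mh} (hP4 : ∀ μ, 4 ≤ P' μ) (hMh : 2 ≤ Mh) (hM8 : 8 ≤ Mh) (hR : 2 * (ℓ + 1) ≤ R) (hP5 : ∀ μ, 5 ≤ P' μ)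
    (c : ↥(cubes D.toDomains)) (cf : ℝ) (ν : Fin (d + 1)) (T : Module.End ℝ (PBond (PV d ℓ m K hd hL) 0 → ℝ))
    {N : (geomT D).Site → (PBond (PV d ℓ m K hd hL) 0 → ℝ) → ℝ} :
    ∀ (y' : (geomT D).Site) (μ : PBond (PV d ℓ m K hd hL) 0 → ℝ) (B : ℝ),
      NormSupp (g := geomT D) (blkV1 hN D) (fun y' => ({y'} : Set (geomT D).Site)) N μ y' B → y' ∉ ST D hMh1 hP4 c →
        (T * mulOp (hB hN D c) * DVa (P := PV d ℓ m K hd hL) ν cf) μ = 0 := by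
  intro y' μ B hμ hy'
  have hzero : mulOp (hB hN D c) (DVa (P := PV d ℓ m K hd hL) ν cf μ) = 0 := by
    funext x
    rw [mulOp_apply, DVa_apply, Pi.zero_apply]
    by_cases hx : hB hN D c x = 0
    · rw [hx, zero_mul]
    · -- `h_{□′}(x) ≠ 0`: the blocks of `x` and `x − e_ν` lie in `□′⁺ ∌ y′`, so `μ` vanishes at both
      have h1 : blkV1 hN D x ∈ ST D hMh1 hP4 c := blkV1_mem_QT_of_hB_ne_zero hN D hMh hR hP4 c hx
      have h2 : blkV1 hN D ⟨x.src.unshift ν, x.dir⟩ ∈ ST D hMh1 hP4 c := by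
        refine blkV1_mem_ST_of_hB_shift_ne_zero hN hMh1 hP4 c hM8 hR hP5 ν ?_
        have e : ((⟨x.src.unshift ν, x.dir⟩ : PBond (PV d ℓ m K hd hL) 0).src.shift ν) = x.src :=
          (LatticeFieldCalculus.shiftEquiv (P := PV d ℓ m K hd hL) (j := 0) ν).apply_symm_apply x.src
        rw [e]; exact hx
      have hμ1 : μ x = 0 := hμ.off x (fun hmem => hy' (by rw [Set.mem_singleton_iff] at hmem; rw [← hmem]; exact h1))
      have hμ2 : μ ⟨x.src.unshift ν, x.dir⟩ = 0 :=
        hμ.off _ (fun hmem => hy' (by rw [Set.mem_singleton_iff] at hmem; rw [← hmem]; exact h2))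
      rw [hμ1, hμ2, sub_zero, mul_zero, mul_zero]
  rw [Module.End.mul_apply, Module.End.mul_apply, hzero, map_zero]

end Side

/-! ## §2  The `n = 0` term `∇_μG₀∇*_ν = Σ_□ ∇_μ(h_□G_□h_□)∇*_ν` on the census Hölder class -/

section GZero

open Classical in
/-- **THE `n = 0` TERM OF (2.141) FOR `|(∇G∇*J)(x)|` AT k LEVELS, GLUED**: for the weight band there are `ρ₀ > 0` and, for every `0 < ε < 1`, `C₀ ≥ 0` such
that on every admissible V1 torus (`M_h = Lᵃ ≥ 8`, `R ≥ 2L²`, `P′ ≥ 5`, `L ≥ 5`, cubes placed), for `c′ ≠ 0`, weights `w` and directions `μ, ν`: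
`HasMajorantA (NormSupp (blkV1) {y′} (‖·‖_ε + |·|)) (Σ_□ ∇_μ(h_□G_□h_□)∇*_ν) ((3·9^{d+1})·C₀·e^{−ρ₀ d_T(y,y′)})` — p27's per-cube leg
`…B6Grad2NormSuppLegKLevelV1.hD2hGh0_cube` (reach `□⁺ ⊆ □̃`) summed with the overlap `3·9^{d+1}` of the `□̃` (`…card_filter_mem_QbigT_le`).
[cite: Balaban1984PropagatorsII, Prop. 2.6 (2.138) p.247, (2.141) p.247 (n = 0), (2.90) p.239, p.235] -/
theorem gradGZeroDiv_normSupp (d ℓ : ℕ) (hd : 1 ≤ d + 1) (hL : Odd (ℓ + 1) ∧ 1 < ℓ + 1) {a₀ a₁ : ℝ} (ha₀ : 0 < a₀) (ha₁ : a₀ ≤ a₁) :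
    ∃ ρ₀ : ℝ, 0 < ρ₀ ∧ ∀ ε : ℝ, 0 < ε → ε < 1 → ∃ C₀ : ℝ, 0 ≤ C₀ ∧ ∀ (m K : ℕ) {Mh k R : ℕ} {P' : Fin (d + 1) → ℕ}
      (hN : ∀ μ, N0 ℓ Mh k P' μ = (PV d ℓ m K hd hL).sitesPerDir 0) (D : TDomains d ℓ Mh k P' R) (hk : k ≤ m + K)
      (hMh1 : 1 ≤ Mh) (hP4 : ∀ μ, 4 ≤ P' μ) {a : ℕ} (hMha : Mh = (ℓ + 1) ^ a) (_ : 8 ≤ Mh) (_ : 2 * (ℓ + 1) ^ 2 ≤ R) (_ : ∀ μ, 5 ≤ P' μ)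
      (_ : 4 ≤ ℓ) (hpl : ∀ c : ↥(cubes D.toDomains), Placed ℓ k P' c.1) (w : BondIdx (domT hN D hk) → ℝ) {cf : ℝ} (_ : cf ≠ 0) (μ ν : Fin (d + 1)),
      HasMajorantA (g := geomT D) (blkV1 hN D)
        (NormSupp (g := geomT D) (blkV1 hN D) (fun y' => ({y'} : Set (geomT D).Site)) (fun _ J => holderV1 hN D ε J + supNormV1 J))
        (∑ c : ↥(cubes D.toDomains),
          DV (P := PV d ℓ m K hd hL) μ cf * (mulOp (hB hN D c) * Gl hN hk hMh1 hP4 hMha c ha₁ (hpl c) w cf * mulOp (hB hN D c)) *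
            DVa (P := PV d ℓ m K hd hL) ν cf)
        (fun y y' => ((3 * 9 ^ (d + 1) : ℕ) : ℝ) * (C₀ * Real.exp (-(ρ₀ * (geomT D).dist y y')))) := by
  obtain ⟨ρ₀, hρ₀, H⟩ := hD2hGh0_cube d ℓ hd hL ha₀ ha₁
  refine ⟨ρ₀, hρ₀, fun ε hε0 hε1 => ?_⟩
  obtain ⟨C₀, hC₀, h0⟩ := H ε hε0 hε1
  refine ⟨C₀, hC₀, ?_⟩
  intro m K Mh k R P' hN D hk hMh1 hP4 a hMha hM8 hR2 hP5 hℓ hpl w cf hcf μ ν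
  have hMh : 2 ≤ Mh := le_trans (by norm_num) hM8
  -- every leg, localised in output to `□⁺ ⊆ □̃`
  have hlegs : ∀ c ∈ (Finset.univ : Finset ↥(cubes D.toDomains)), HasMajorantA (g := geomT D) (blkV1 hN D)
      (NormSupp (g := geomT D) (blkV1 hN D) (fun y' => ({y'} : Set (geomT D).Site)) (fun _ J => holderV1 hN D ε J + supNormV1 J))
      (DV (P := PV d ℓ m K hd hL) μ cf * (mulOp (hB hN D c) * Gl hN hk hMh1 hP4 hMha c ha₁ (hpl c) w cf * mulOp (hB hN D c)) *
        DVa (P := PV d ℓ m K hd hL) ν cf)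
      (fun y y' => ind (SbigT D hMh1 hP4 c) y * (C₀ * Real.exp (-(ρ₀ * (geomT D).dist y y')))) := by
    intro c _
    refine hasMajorantA_mono (g := geomT D) (blkV1 hN D) (h0 m K hN D hk hMh1 hP4 hMha hM8 hR2 hP5 hℓ c (hpl c) w hcf μ ν)
      (fun _ _ _ hμ => hμ.nonneg) fun y y' => ?_
    have hK : 0 ≤ C₀ * Real.exp (-(ρ₀ * (geomT D).dist y y')) := by positivity
    by_cases hy : y ∈ ST D hMh1 hP4 c
    · rw [ind_of_mem hy, ind_of_mem (ST_subset_SbigT D hMh1 hP4 c hy), one_mul, one_mul]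
      exact (mul_le_of_le_one_left hK (ind_le_one _ _))
    · rw [ind_of_not_mem hy, zero_mul, zero_mul]
      exact mul_nonneg (ind_nonneg _ _) hK
  exact hasMajorantA_sum_overlap (g := geomT D) (blkV1 hN D) Finset.univ (fun c => SbigT D hMh1 hP4 c) _
    (fun y y' => C₀ * Real.exp (-(ρ₀ * (geomT D).dist y y'))) (fun y y' => by positivity) (fun _ _ _ hμ => hμ.nonneg) hlegs
    (3 * 9 ^ (d + 1)) (hNov_SbigT_of_QbigT D hMh1 hP4 (fun y => card_filter_mem_QbigT_le D hL hMh hR2 hMh1 hP4 y))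

end GZero

/-! ## §3  (2.138) at k levels in print's series order, GIVEN the last legs `K_{□,□′}G_{□′}h_{□′}∇*_ν` on Hölder inputs -/

section Skeleton

set_option maxHeartbeats 1600000 in
open Classical in
/-- **PROPOSITION 2.6 (2.138) `|(∇_μG∇*_νJ)(x)| ≤ O(1)e^{−δ₃d(y,y′)}(‖J‖_ε + |J|)` FOR THE GENUINE k-LEVEL `G = Δ_a⁻¹` ON THE V1 TORUS, GIVEN THE LAST
LEGS** (the walk (2.141) in print's series order `∇_μG∇*_ν = ∇_μG₀∇*_ν + (∇_μG)·(R∇*_ν)`): for the weight band `[b₀, b₁]` there is `σ₀ > 0` and, for every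
Hölder exponent `0 < ε < 1` and rate `0 < σ ≤ σ₀`, constants `A ≥ 0`, `M₂ > 0` such that on every admissible V1 torus (`k ≥ 2`, `M_h = Lᵃ ≥ 8`, `R ≥ 2L²`,
`P′ ≥ 5`, `L ≥ 5`, cubes placed, `M₂ ≤ L·M_h`), for `c′ ≠ 0`, positive weights in the global band and directions `μ, ν`, GIVEN the last legs
`K_{□,□′}G_{□′}h_{□′}∇*_ν` of EVERY pair of cubes of the genuine (2.91) family on the census Hölder class «supp J ⊂ Δ(y′), ‖J‖_ε + |J| ≤ B» with the
majorant `θ·(|c′|/L^{j(y′)})·e^{−σ d_T(y,y′)}` (`θ ≥ 0` arbitrary: no smallness is needed at this step), the genuine `∇_μG∇*_ν` has the majorant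
`A·(1 + θ)·e^{−(σ/8) d_T(y,y′)}` on that class — print's `O(1)e^{−δ₃d(y,y′)}(‖J‖^{ξ′}_ε + |J|)`.  T₀ = §2 (transported to the input block), S = (2.136)₂
(`…prop26_2136_grad_kLevel_unconditional`), T₁ = the displayed legs glued with the overlap `3·9^{d+1}` (outputs in `□̃`, inputs in `□′⁺`), chain =
`…prop26_chain_2138With` with Lemma 2.1 (`…lemma21_torus`), then the level-gap transport of `L^{j(y)}/L^{j(y′)}` (`…len_le_of_levelGap`).
[cite: Balaban1984PropagatorsII, Prop. 2.6 (2.138) p.247, (2.141) p.247, (2.133)–(2.135) p.247, (2.90)–(2.93) p.239, Lemma 2.1 (2.63) p.234, p.235] -/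
theorem ineq2138_kLevel_skeleton (d ℓ : ℕ) (hd : 1 ≤ d + 1) (hL : Odd (ℓ + 1) ∧ 1 < ℓ + 1) {b₀ b₁ : ℝ} (hb₀ : 0 < b₀) (hb₁ : b₀ ≤ b₁) :
    ∃ σ₀ : ℝ, 0 < σ₀ ∧ ∀ σ : ℝ, 0 < σ → σ ≤ σ₀ → ∃ M₂ : ℝ, 0 < M₂ ∧ ∀ ε : ℝ, 0 < ε → ε < 1 → ∃ A : ℝ, 0 ≤ A ∧
    ∀ (m K : ℕ) {Mh k R : ℕ} {P' : Fin (d + 1) → ℕ}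
      (hN : ∀ μ, N0 ℓ Mh k P' μ = (PV d ℓ m K hd hL).sitesPerDir 0) (D : TDomains d ℓ Mh k P' R) (hk : k ≤ m + K) (_ : 2 ≤ k)
      {a : ℕ} (hMha : Mh = (ℓ + 1) ^ a) (hM8 : 8 ≤ Mh) (_ : 2 * (ℓ + 1) ^ 2 ≤ R) (hP5 : ∀ μ, 5 ≤ P' μ) (_ : 4 ≤ ℓ)
      (hpl : ∀ c : ↥(cubes D.toDomains), Placed ℓ k P' c.1) (_ : M₂ ≤ ((ℓ : ℝ) + 1) * Mh)
      {cf : ℝ} (hcf : cf ≠ 0) {w : BondIdx (domT hN D hk) → ℝ} (hw : ∀ i, 0 < w i) (_ : GlobalBand b₀ b₁ cf w)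
      (μ ν : Fin (d + 1))
      -- the displayed last legs `K_{□,□′}G_{□′}h_{□′}∇*_ν` on the Hölder class, rate `σ`
      (θ : ℝ) (_ : 0 ≤ θ)
      (_ : ∀ c c' : ↥(cubes D.toDomains), HasMajorantA (g := geomT D) (blkV1 hN D)
        (NormSupp (g := geomT D) (blkV1 hN D) (fun y' => ({y'} : Set (geomT D).Site)) (fun _ J => holderV1 hN D ε J + supNormV1 J))
        (kFam (onFun (dE (P := PV d ℓ m K hd hL) cf ∘ₗ (LinearMap.id - RE (domT hN D hk) cf) ∘ₗ dsE cf))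
            (fun c => mulOp (hB hN D c)) (fun c => mulOp (zB hN D (one_le_of_eight_le hM8) (four_le_of_five_le hP5) c))
            (fun c => Ml hN hk (one_le_of_eight_le hM8) (four_le_of_five_le hP5) hMha c (band_le (d := d) (ℓ := ℓ) hb₀ hb₁) (hpl c) w cf)
            (fun c => Pl hN hk (one_le_of_eight_le hM8) (four_le_of_five_le hP5) hMha c (band_le (d := d) (ℓ := ℓ) hb₀ hb₁) (hpl c) w cf) c c' *
          Gl hN hk (one_le_of_eight_le hM8) (four_le_of_five_le hP5) hMha c' (band_le (d := d) (ℓ := ℓ) hb₀ hb₁) (hpl c') w cf *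
          mulOp (hB hN D c') * DVa (P := PV d ℓ m K hd hL) ν cf)
        (fun y y' => θ * (|cf| / (geomT D).len y') * Real.exp (-(σ * (geomT D).dist y y')))),
      HasMajorantA (g := geomT D) (blkV1 hN D)
        (NormSupp (g := geomT D) (blkV1 hN D) (fun y' => ({y'} : Set (geomT D).Site)) (fun _ J => holderV1 hN D ε J + supNormV1 J))
        (DV (P := PV d ℓ m K hd hL) μ cf * onFun (GE (domT hN D hk) hcf hw) * DVa (P := PV d ℓ m K hd hL) ν cf)
        (fun y y' => A * (1 + θ) * Real.exp (-(σ / 8 * (geomT D).dist y y'))) := by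
  have ha₀ : (0 : ℝ) < b₀ / ((ℓ + 1 : ℕ) : ℝ) := by positivity
  obtain ⟨ρ₀, hρ₀, H0⟩ := gradGZeroDiv_normSupp d ℓ hd hL ha₀ (band_le (d := d) (ℓ := ℓ) hb₀ hb₁)
  obtain ⟨σ₁, hσ₁, HS⟩ := prop26_2136_grad_kLevel_unconditional d ℓ hd hL hb₀ hb₁
  refine ⟨min (ρ₀ / 2) σ₁, lt_min (by positivity) hσ₁, fun σ hσ hσle => ?_⟩
  have hσρ : σ ≤ ρ₀ / 2 := hσle.trans (min_le_left _ _)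
  have hσ1 : σ ≤ σ₁ := hσle.trans (min_le_right _ _)
  -- `S = ∇_μG` at the rate `delta3 ½ (2σ) = σ/2`
  obtain ⟨AS, M₂, hAS, hM₂, hS⟩ := HS σ hσ hσ1 (1 / 2) (by norm_num) (by norm_num)
  -- the Lemma-2.1 exponent and the two transport exponents
  set N₀ : ℕ := ⌈2 * ((d : ℝ) + 1) * Real.log ((ℓ : ℝ) + 1) / (1 / 2 * (σ / 2))⌉₊ + 1 with hN₀
  set N₁ : ℕ := ⌈2 * Real.log ((ℓ : ℝ) + 1) / σ⌉₊ + 1 with hN₁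
  set N₂ : ℕ := ⌈2 * Real.log ((ℓ : ℝ) + 1) / (σ / 4)⌉₊ + 1 with hN₂
  set cK : ℝ := K261 N₀ (d + 1) ((ℓ : ℝ) + 1) 1 (1 / 2 * (σ / 2)) with hcK
  have hcK0 : 0 ≤ cK := K261_nonneg (by positivity) zero_le_one
  set Nb : ℝ := ((3 * 9 ^ (d + 1) : ℕ) : ℝ) with hNb
  have hNb0 : 0 ≤ Nb := Nat.cast_nonneg _
  set Lr : ℝ := (ℓ : ℝ) + 1 with hLr
  have hLr1 : 1 ≤ Lr := by rw [hLr]; linarith [(Nat.cast_nonneg ℓ : (0 : ℝ) ≤ ℓ)]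
  have hLr0 : 0 ≤ Lr := zero_le_one.trans hLr1
  refine ⟨max M₂ ((N₀ : ℝ) + 1 + N₁ + N₂), lt_max_of_lt_left hM₂, fun ε hε0 hε1 => ?_⟩
  obtain ⟨C₀, hC₀, h0⟩ := H0 ε hε0 hε1
  -- the constant
  set A : ℝ := (Nb * C₀ * Lr + AS * Nb ^ 2 * cK ^ 2) * Lr with hA
  have hA0 : 0 ≤ A := by positivity
  refine ⟨A, hA0, ?_⟩
  intro m K Mh k R P' hN D hk hk2 a hMha hM8 hR2 hP5 hℓ hpl hLM cf hcf w hw hwb μ ν θ hθ h2134D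
  -- ### the torus
  have hMh1 : 1 ≤ Mh := one_le_of_eight_le hM8
  have hP4 : ∀ μ, 4 ≤ P' μ := four_le_of_five_le hP5
  have hP : ∀ μ, 1 ≤ P' μ := one_le_of_four_le hP4
  have hMh : 2 ≤ Mh := le_trans (by norm_num) hM8
  have hR : 2 * (ℓ + 1) ≤ R := le_trans (by nlinarith : 2 * (ℓ + 1) ≤ 2 * (ℓ + 1) ^ 2) hR2
  have hR1 : 1 ≤ R := le_trans (by nlinarith : 1 ≤ 2 * (ℓ + 1) ^ 2) hR2
  have hdnn : ∀ y y' : (geomT D).Site, 0 ≤ (geomT D).dist y y' := fun _ _ => Nat.cast_nonneg _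
  obtain ⟨htri, hrefl, -⟩ := triangle_refl_nonneg_T D hMh1 hP
  -- thresholds
  have hLM₂ : M₂ ≤ ((ℓ : ℝ) + 1) * Mh := (le_max_left _ _).trans hLM
  have hLMN : (N₀ : ℝ) + 1 + N₁ + N₂ ≤ ((ℓ : ℝ) + 1) * Mh := (le_max_right _ _).trans hLM
  have hN0c : (N₀ : ℝ) + 1 + N₁ + N₂ ≤ ((ℓ : ℝ) + 1) * Mh := hLMN
  have hn1 : (0 : ℝ) ≤ N₁ := Nat.cast_nonneg N₁
  have hn2 : (0 : ℝ) ≤ N₂ := Nat.cast_nonneg N₂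
  have hn0 : (0 : ℝ) ≤ N₀ := Nat.cast_nonneg N₀
  have hRM : N₀ + 1 ≤ R * ((ℓ + 1) * Mh) :=
    nat_le_RLM (N := N₀ + 1) (M₂ := (N₀ : ℝ) + 1 + N₁ + N₂) (by push_cast; linarith) hN0c hR1
  have hRM1 : N₁ ≤ R * ((ℓ + 1) * Mh) := nat_le_RLM (N := N₁) (M₂ := (N₀ : ℝ) + 1 + N₁ + N₂) (by linarith) hN0c hR1
  have hRM2 : N₂ ≤ R * ((ℓ + 1) * Mh) := nat_le_RLM (N := N₂) (M₂ := (N₀ : ℝ) + 1 + N₁ + N₂) (by linarith) hN0c hR1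
  have habs1 : 2 * Real.log ((ℓ : ℝ) + 1) ≤ σ * (((R * ((ℓ + 1) * Mh) - 1 : ℕ)) : ℝ) := transport_of_le hσ (by rw [hN₁] at hRM1; exact hRM1)
  have habs2 : 2 * Real.log ((ℓ : ℝ) + 1) ≤ σ / 4 * (((R * ((ℓ + 1) * Mh) - 1 : ℕ)) : ℝ) :=
    transport_of_le (by positivity) (by rw [hN₂] at hRM2; exact hRM2)
  -- Lemma 2.1 at `(δ, α) = (σ/2, ½)`
  have hbud : Real.exp (-(1 / 2 * (σ / 2))) * ((ℓ : ℝ) + 1) ^ ((2 * (d + 1 : ℕ) : ℝ) / N₀) < 1 := by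
    rw [hN₀]; exact budget_lt_one (by norm_num) (by positivity)
  obtain ⟨-, -, -, h263⟩ := lemma21_torus D hMh1 hP (Nat.succ_pos _) hRM (by positivity : (0 : ℝ) ≤ σ / 2) (by norm_num : (0 : ℝ) ≤ 1 / 2)
    (by norm_num : (1 : ℝ) / 2 ≤ 1) hbud
  -- ### abbreviations of the genuine family
  set Dg : Module.End ℝ (PBond (PV d ℓ m K hd hL) 0 → ℝ) :=
    onFun (dE (P := PV d ℓ m K hd hL) cf ∘ₗ (LinearMap.id - RE (domT hN D hk) cf) ∘ₗ dsE cf) with hDg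
  set Gls : ↥(cubes D.toDomains) → Module.End ℝ (PBond (PV d ℓ m K hd hL) 0 → ℝ) :=
    fun c => Gl hN hk hMh1 hP4 hMha c (band_le (d := d) (ℓ := ℓ) hb₀ hb₁) (hpl c) w cf with hGls
  set Mls : ↥(cubes D.toDomains) → Module.End ℝ (PBond (PV d ℓ m K hd hL) 0 → ℝ) :=
    fun c => Ml hN hk hMh1 hP4 hMha c (band_le (d := d) (ℓ := ℓ) hb₀ hb₁) (hpl c) w cf with hMls
  set Pls : ↥(cubes D.toDomains) → Module.End ℝ (PBond (PV d ℓ m K hd hL) 0 → ℝ) :=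
    fun c => Pl hN hk hMh1 hP4 hMha c (band_le (d := d) (ℓ := ℓ) hb₀ hb₁) (hpl c) w cf with hPls
  set hBs : ↥(cubes D.toDomains) → Module.End ℝ (PBond (PV d ℓ m K hd hL) 0 → ℝ) := fun c => mulOp (hB hN D c) with hhBs
  set zBs : ↥(cubes D.toDomains) → Module.End ℝ (PBond (PV d ℓ m K hd hL) 0 → ℝ) := fun c => mulOp (zB hN D hMh1 hP4 c) with hzBs
  set Dμ : Module.End ℝ (PBond (PV d ℓ m K hd hL) 0 → ℝ) := DV (P := PV d ℓ m K hd hL) μ cf with hDμ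
  set Dν : Module.End ℝ (PBond (PV d ℓ m K hd hL) 0 → ℝ) := DVa (P := PV d ℓ m K hd hL) ν cf with hDν
  set adm : (PBond (PV d ℓ m K hd hL) 0 → ℝ) → (geomT D).Site → ℝ → Prop :=
    NormSupp (g := geomT D) (blkV1 hN D) (fun y' => ({y'} : Set (geomT D).Site)) (fun _ J => holderV1 hN D ε J + supNormV1 J) with hadm
  have hadm0 : ∀ (J : PBond (PV d ℓ m K hd hL) 0 → ℝ) (y' : (geomT D).Site) (B : ℝ), adm J y' B → 0 ≤ B := fun _ _ _ hJ => hJ.nonneg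
  -- the weights
  set Pw : (geomT D).Site → ℝ := fun y => (geomT D).len y * |cf|⁻¹ with hPw
  set Qw : (geomT D).Site → ℝ := fun y' => |cf| / (geomT D).len y' with hQw
  have hlenT : ∀ y : (geomT D).Site, 0 < (geomT D).len y := fun y => by rw [geomT_len]; positivity
  have hPw0 : ∀ y, 0 ≤ Pw y := fun y => by rw [hPw]; exact mul_nonneg (hlenT y).le (inv_nonneg.2 (abs_nonneg _))
  have hQw0 : ∀ y, 0 ≤ Qw y := fun y => by rw [hQw]; exact div_nonneg (abs_nonneg _) (hlenT y).le
  have hcfabs : 0 < |cf| := abs_pos.2 hcf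
  have hPQ : ∀ y y' : (geomT D).Site, Pw y * Qw y' = (geomT D).len y / (geomT D).len y' := fun y y' => by
    rw [hPw, hQw]; field_simp
  have elenTB : ∀ y : (geomT D).Site, (geomTB D).len y = (geomT D).len y := fun y => by rw [geomTB_len, geomT_len]
  -- ### (2.91) for the genuine family and the fixed point, conjugated by `∇_μ`, `∇*_ν`
  have h291 : onFun (deltaAE (domT hN D hk) cf w) * gZero Finset.univ hBs Gls = 1 - rOp Finset.univ Dg hBs zBs Gls Mls Pls := by
    rw [deltaAE_split]
    exact eq291 Finset.univ _ _ hBs zBs Gls Mls Pls (sum_mulOp_hB_sq hN D hMh1 hP)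
      (fun c _ => hagree_cube hN hk hMh1 hP4 hMha c (band_le (d := d) (ℓ := ℓ) hb₀ hb₁) hk2 hM8 hR2 (hpl c) w hcf
        (fun i hi _ => band_of_global hN hk hMh1 hP4 c (le_of_lt hb₀) hcf w hwb i hi))
      (fun c _ => hinvl_cube hN hk hMh1 hP4 hMha c (band_le (d := d) (ℓ := ℓ) hb₀ hb₁) ha₀ hM8 hR2 (hpl c) w hcf)
      (fun c _ => mulOp_zB_mul_hB hN D hMh hR hP4 c) (fun c _ => mulOp_hB_mul_zB hN D hMh hR hP4 c)
  have hinv := onFun_GE_mul_deltaAE (domT hN D hk) hcf hw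
  have hfix0 : onFun (GE (domT hN D hk) hcf hw) =
      gZero Finset.univ hBs Gls + onFun (GE (domT hN D hk) hcf hw) * rOp Finset.univ Dg hBs zBs Gls Mls Pls := fixedPoint_of_291 hinv h291
  have hfix := conj_fixedPoint Dμ Dν hfix0
  -- ### T₀: the n = 0 term, transported to the shape `A₀·P(y)Q(y′)·e^{−(σ/2)d}`
  have hG0 : Dμ * gZero Finset.univ hBs Gls * Dν = ∑ c ∈ (Finset.univ : Finset ↥(cubes D.toDomains)), Dμ * (hBs c * Gls c * hBs c) * Dν := by
    unfold gZero; rw [Finset.mul_sum, Finset.sum_mul]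
  have hT0 : HasMajorantA (g := geomT D) (blkV1 hN D) adm (Dμ * gZero Finset.univ hBs Gls * Dν)
      (fun y y' => Nb * C₀ * Lr * Pw y * Qw y' * Real.exp (-(σ / 2 * (geomT D).dist y y'))) := by
    rw [hG0]
    refine hasMajorantA_mono (g := geomT D) (blkV1 hN D) (h0 m K hN D hk hMh1 hP4 hMha hM8 hR2 hP5 hℓ hpl w hcf μ ν) hadm0 fun y y' => ?_
    -- `C₀e^{−ρ₀d} ≤ C₀·L·e^{(σ/2)d}·(L^{j(y)}/L^{j(y′)})·e^{−ρ₀d}` and `ρ₀ − σ/2 ≥ σ/2`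
    have hl := len_le_of_levelGap D hMh1 hP hσ.le habs1 y y'
    rw [elenTB, elenTB] at hl
    have hdd := hdnn y y'
    have hE0 := Real.exp_nonneg (-(ρ₀ * (geomT D).dist y y'))
    have hrate : Real.exp (σ / 2 * (geomT D).dist y y') * Real.exp (-(ρ₀ * (geomT D).dist y y')) ≤ Real.exp (-(σ / 2 * (geomT D).dist y y')) := by
      rw [← Real.exp_add]; apply Real.exp_le_exp.mpr; nlinarith
    have hly' := hlenT y'
    have hratio : 0 ≤ (geomT D).len y / (geomT D).len y' := div_nonneg (hlenT y).le hly'.le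
    have hNC : 0 ≤ Nb * C₀ := mul_nonneg hNb0 hC₀
    calc Nb * (C₀ * Real.exp (-(ρ₀ * (geomT D).dist y y')))
        = Nb * C₀ * ((geomT D).len y' / (geomT D).len y') * Real.exp (-(ρ₀ * (geomT D).dist y y')) := by
          rw [div_self hly'.ne']; ring
      _ ≤ Nb * C₀ * ((Lr * Real.exp (σ / 2 * (geomT D).dist y y') * (geomT D).len y) / (geomT D).len y') *
          Real.exp (-(ρ₀ * (geomT D).dist y y')) :=
          mul_le_mul_of_nonneg_right (mul_le_mul_of_nonneg_left (div_le_div_of_nonneg_right hl hly'.le) hNC) hE0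
      _ = Nb * C₀ * Lr * ((geomT D).len y / (geomT D).len y') *
          (Real.exp (σ / 2 * (geomT D).dist y y') * Real.exp (-(ρ₀ * (geomT D).dist y y'))) := by ring
      _ ≤ Nb * C₀ * Lr * ((geomT D).len y / (geomT D).len y') * Real.exp (-(σ / 2 * (geomT D).dist y y')) :=
          mul_le_mul_of_nonneg_left hrate (mul_nonneg (mul_nonneg hNC hLr0) hratio)
      _ = Nb * C₀ * Lr * Pw y * Qw y' * Real.exp (-(σ / 2 * (geomT D).dist y y')) := by rw [mul_assoc (Nb * C₀ * Lr) (Pw y), hPQ]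
  -- ### S = ∇_μG ((2.136)₂, rate σ/2)
  obtain ⟨-, hS1⟩ := hS m K hN D hk hk2 hMha hM8 hR2 hP5 hℓ hpl hLM₂ hcf hw hwb
  have hSμ : HasMajorant (g := geomT D) (blkV1 hN D) (Dμ * onFun (GE (domT hN D hk) hcf hw))
      (fun y y' => AS * Pw y * Real.exp (-(σ / 2 * (geomT D).dist y y'))) := by
    refine hasMajorant_mono (g := geomT D) (blkV1 hN D) (hS1 μ) fun y y' => le_of_eq ?_
    rw [hPw]; simp only [delta3]; ring_nf
  -- ### T₁ = R·∇*_ν: the displayed legs, localised and glued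
  have hRsum : rOp Finset.univ Dg hBs zBs Gls Mls Pls * Dν =
      ∑ c ∈ (Finset.univ : Finset ↥(cubes D.toDomains)), ∑ c' ∈ (Finset.univ : Finset ↥(cubes D.toDomains)),
        kFam Dg hBs zBs Mls Pls c c' * Gls c' * hBs c' * Dν := by
    unfold rOp; rw [Finset.sum_mul]; refine Finset.sum_congr rfl fun c _ => ?_; rw [Finset.sum_mul]
  have hMout : ∀ c, OutLoc (g := geomT D) (blkV1 hN D) (Mls c * mulOp (hB hN D c)) (SbigT D hMh1 hP4 c) :=
    fun c => outLoc_Ml_hB' hN hk hMh1 hP4 hMha c (band_le (d := d) (ℓ := ℓ) hb₀ hb₁) hM8 hR2 hP5 (hpl c) w cf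
  have hpairs : ∀ c ∈ (Finset.univ : Finset ↥(cubes D.toDomains)), ∀ c' ∈ (Finset.univ : Finset ↥(cubes D.toDomains)),
      HasMajorantA (g := geomT D) (blkV1 hN D) adm (kFam Dg hBs zBs Mls Pls c c' * Gls c' * hBs c' * Dν)
        (fun y y' => ind (SbigT D hMh1 hP4 c) y * ind (SbigT D hMh1 hP4 c') y' * (θ * Qw y' * Real.exp (-(σ / 2 * (geomT D).dist y y')))) := by
    intro c _ c' _
    have hout : OutLoc (g := geomT D) (blkV1 hN D) (kFam Dg hBs zBs Mls Pls c c' * Gls c' * hBs c' * Dν) (SbigT D hMh1 hP4 c) :=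
      outLoc_mul _ (outLoc_mul _ (outLoc_kFam_big hN D hMh hR hMh1 hP4 Dg Gls Mls Pls hMout c c') _) _
    have hin := inKill_hB_DVa hN D (hMh1 := hMh1) hP4 hMh hM8 hR hP5 c' cf ν (kFam Dg hBs zBs Mls Pls c c' * Gls c')
      (N := fun _ J => holderV1 hN D ε J + supNormV1 J)
    have hloc := hasMajorantA_localise (g := geomT D) (blkV1 hN D) (h2134D c c') hout hin
    refine hasMajorantA_mono (g := geomT D) (blkV1 hN D) hloc hadm0 fun y y' => ?_
    have hK : 0 ≤ θ * Qw y' * Real.exp (-(σ / 2 * (geomT D).dist y y')) := mul_nonneg (mul_nonneg hθ (hQw0 y')) (Real.exp_nonneg _)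
    have h1 : ind (ST D hMh1 hP4 c') y' ≤ ind (SbigT D hMh1 hP4 c') y' := by
      by_cases hy : y' ∈ ST D hMh1 hP4 c'
      · rw [ind_of_mem hy, ind_of_mem (ST_subset_SbigT D hMh1 hP4 c' hy)]
      · rw [ind_of_not_mem hy]; exact ind_nonneg _ _
    have h2 : θ * (|cf| / (geomT D).len y') * Real.exp (-(σ * (geomT D).dist y y')) ≤ θ * Qw y' * Real.exp (-(σ / 2 * (geomT D).dist y y')) :=
      mul_le_mul_of_nonneg_left (exp_le_exp_of_rate (by linarith) (hdnn y y')) (mul_nonneg hθ (hQw0 y'))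
    exact mul_le_mul (mul_le_mul_of_nonneg_left h1 (ind_nonneg _ _)) h2
      (mul_nonneg (mul_nonneg hθ (div_nonneg (abs_nonneg _) (hlenT y').le)) (Real.exp_nonneg _))
      (mul_nonneg (ind_nonneg _ _) (ind_nonneg _ _))
  have hT1 : HasMajorantA (g := geomT D) (blkV1 hN D) adm (rOp Finset.univ Dg hBs zBs Gls Mls Pls * Dν)
      (fun y y' => Nb ^ 2 * θ * Qw y' * Real.exp (-(σ / 2 * (geomT D).dist y y'))) := by
    rw [hRsum]
    have h := hasMajorantA_sum_pairs_overlap (g := geomT D) (blkV1 hN D) Finset.univ (fun c => SbigT D hMh1 hP4 c)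
      (fun c c' => kFam Dg hBs zBs Mls Pls c c' * Gls c' * hBs c' * Dν) (fun y y' => θ * Qw y' * Real.exp (-(σ / 2 * (geomT D).dist y y')))
      (fun y y' => mul_nonneg (mul_nonneg hθ (hQw0 y')) (Real.exp_nonneg _)) hadm0 hpairs (3 * 9 ^ (d + 1))
      (hNov_SbigT_of_QbigT D hMh1 hP4 (fun y => card_filter_mem_QbigT_le D hL hMh hR2 hMh1 hP4 y))
    refine hasMajorantA_mono (g := geomT D) (blkV1 hN D) h hadm0 fun y y' => le_of_eq ?_
    rw [hNb]; ring
  -- ### the chain `T = T₀ + S·T₁`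
  have hchain := prop26_chain_2138With (g := geomT D) (blkV1 hN D) (adm := adm) cK (σ / 2) (1 / 2) (Nb * C₀ * Lr) AS (Nb ^ 2 * θ) Pw Qw
    (by positivity) hAS (by positivity) hPw0 hQw0 (by positivity) (by norm_num) hdnn (by rw [hcK]; exact h263) hadm0 hfix hT0 hSμ hT1
  -- ### the transport of `L^{j(y)}/L^{j(y′)}` and the final constant
  have hθc : (Nb * C₀ * Lr + AS * (Nb ^ 2 * θ) * cK ^ 2) * Lr ≤ A * (1 + θ) := by
    rw [hA]
    have h1 : 0 ≤ Nb * C₀ * Lr * Lr * θ := by positivity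
    have h2 : 0 ≤ AS * Nb ^ 2 * cK ^ 2 * Lr := by positivity
    nlinarith
  have hσ4 : (0 : ℝ) ≤ σ / 4 := by positivity
  refine hasMajorantA_mono (g := geomT D) (blkV1 hN D) hchain hadm0 (fun y y' => ?_)
  have hl := len_le_of_levelGap D hMh1 hP hσ4 habs2 y' y
  rw [elenTB, elenTB, symmT D y' y] at hl
  have hdd := hdnn y y'
  have hly' := hlenT y'
  have hrate : Real.exp (σ / 4 / 2 * (geomT D).dist y y') * Real.exp (-((1 - 1 / 2) * (σ / 2) * (geomT D).dist y y')) =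
      Real.exp (-(σ / 8 * (geomT D).dist y y')) := by
    rw [← Real.exp_add]; congr 1; ring
  calc (Nb * C₀ * Lr + AS * (Nb ^ 2 * θ) * cK ^ 2) * Pw y * Qw y' * Real.exp (-((1 - 1 / 2) * (σ / 2) * (geomT D).dist y y'))
      = (Nb * C₀ * Lr + AS * (Nb ^ 2 * θ) * cK ^ 2) * ((geomT D).len y / (geomT D).len y') *
          Real.exp (-((1 - 1 / 2) * (σ / 2) * (geomT D).dist y y')) := by rw [mul_assoc _ (Pw y), hPQ]
    _ ≤ (Nb * C₀ * Lr + AS * (Nb ^ 2 * θ) * cK ^ 2) * ((Lr * Real.exp (σ / 4 / 2 * (geomT D).dist y y') * (geomT D).len y') / (geomT D).len y') *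
          Real.exp (-((1 - 1 / 2) * (σ / 2) * (geomT D).dist y y')) :=
        mul_le_mul_of_nonneg_right (mul_le_mul_of_nonneg_left (div_le_div_of_nonneg_right hl hly'.le) (by positivity)) (Real.exp_nonneg _)
    _ = (Nb * C₀ * Lr + AS * (Nb ^ 2 * θ) * cK ^ 2) * Lr *
          (Real.exp (σ / 4 / 2 * (geomT D).dist y y') * Real.exp (-((1 - 1 / 2) * (σ / 2) * (geomT D).dist y y'))) := by
        field_simp
    _ = (Nb * C₀ * Lr + AS * (Nb ^ 2 * θ) * cK ^ 2) * Lr * Real.exp (-(σ / 8 * (geomT D).dist y y')) := by rw [hrate]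
    _ ≤ A * (1 + θ) * Real.exp (-(σ / 8 * (geomT D).dist y y')) := mul_le_mul_of_nonneg_right hθc (Real.exp_nonneg _)

end Skeleton

/-! ## §4  The census slot `c3` read off the same displayed family -/

section Census

variable {b₀ b₁ : ℝ}

open Classical in
/-- **THE CENSUS SLOT `c3` OF `…B6Prop26PrintedStage2KLevelV1.prop26_kLevel_of_slots5` — PROP. 2.6 (2.138) IN r03's SHAPE VERBATIM
(`(kG i).e4 J y ≤ Cε ε·e^{−δ₃ d(y,y′)}·(‖J‖_ε + |J|)` uniformly on the genuine k-level index `KIdx`, ONE threshold `M₁` and ONE rate `δ₃` chosen before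
`ε`), GIVEN THE LAST LEGS `K_{□,□′}G_{□′}h_{□′}∇*_ν` ON THE HÖLDER CLASS stated uniformly on the family (rate `σ` as a parameter below a `σ_L > 0`, an
`ε`-free threshold `M_L`, a constant `θ(ε)`).** From §3 at `σ := min σ₀ σ_L`, `M₁ := max M₂ M_L`, `δ₃ := σ/8`, `Cε ε := A(ε)·(1 + θ(ε))` (cut to `0` off
`(0,1)`), the reading `…B6HolderNormV1.abs_apply_le_of_suppIn` and the sup over `x ∈ Δ(y)` and the two directions (`…supIn_le`).
[cite: Balaban1984PropagatorsII, Prop. 2.6 (2.138) p.247, (2.141) p.247] -/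
theorem ineq2138_kLevel_census_of_legs (d ℓ : ℕ) (hd : 1 ≤ d + 1) (hL : Odd (ℓ + 1) ∧ 1 < ℓ + 1) (hb₀ : 0 < b₀) (hb₁ : b₀ ≤ b₁)
    (hlegs : ∃ σL : ℝ, 0 < σL ∧ ∀ σ : ℝ, 0 < σ → σ ≤ σL → ∃ ML : ℝ, ∀ ε : ℝ, 0 < ε → ε < 1 → ∃ θ : ℝ, 0 ≤ θ ∧
      ∀ (m K : ℕ) {Mh k R : ℕ} {P' : Fin (d + 1) → ℕ}
        (hN : ∀ μ, N0 ℓ Mh k P' μ = (PV d ℓ m K hd hL).sitesPerDir 0) (D : TDomains d ℓ Mh k P' R) (hk : k ≤ m + K) (_ : 2 ≤ k)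
        {a : ℕ} (hMha : Mh = (ℓ + 1) ^ a) (hM8 : 8 ≤ Mh) (_ : 2 * (ℓ + 1) ^ 2 ≤ R) (hP5 : ∀ μ, 5 ≤ P' μ) (_ : 4 ≤ ℓ)
        (hpl : ∀ c : ↥(cubes D.toDomains), Placed ℓ k P' c.1) (_ : ML ≤ ((ℓ : ℝ) + 1) * Mh)
        {cf : ℝ} (_ : cf ≠ 0) {w : BondIdx (domT hN D hk) → ℝ} (_ : ∀ i, 0 < w i) (_ : GlobalBand b₀ b₁ cf w)
        (ν : Fin (d + 1)) (c c' : ↥(cubes D.toDomains)),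
        HasMajorantA (g := geomT D) (blkV1 hN D)
          (NormSupp (g := geomT D) (blkV1 hN D) (fun y' => ({y'} : Set (geomT D).Site)) (fun _ J => holderV1 hN D ε J + supNormV1 J))
          (kFam (onFun (dE (P := PV d ℓ m K hd hL) cf ∘ₗ (LinearMap.id - RE (domT hN D hk) cf) ∘ₗ dsE cf))
              (fun c => mulOp (hB hN D c)) (fun c => mulOp (zB hN D (one_le_of_eight_le hM8) (four_le_of_five_le hP5) c))
              (fun c => Ml hN hk (one_le_of_eight_le hM8) (four_le_of_five_le hP5) hMha c (band_le (d := d) (ℓ := ℓ) hb₀ hb₁) (hpl c) w cf)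
              (fun c => Pl hN hk (one_le_of_eight_le hM8) (four_le_of_five_le hP5) hMha c (band_le (d := d) (ℓ := ℓ) hb₀ hb₁) (hpl c) w cf) c c' *
            Gl hN hk (one_le_of_eight_le hM8) (four_le_of_five_le hP5) hMha c' (band_le (d := d) (ℓ := ℓ) hb₀ hb₁) (hpl c') w cf *
            mulOp (hB hN D c') * DVa (P := PV d ℓ m K hd hL) ν cf)
          (fun y y' => θ * (|cf| / (geomT D).len y') * Real.exp (-(σ * (geomT D).dist y y')))) :
    ∃ M₁ δ₃ : ℝ, ∃ Cε : ℝ → ℝ, 0 < M₁ ∧ 0 < δ₃ ∧ ∀ i : KIdx d ℓ hd hL b₀ b₁, M₁ ≤ (kGeoG i).M →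
      ∀ (ε : ℝ) (J : (kGeoG i).Loc) (y y' : (kGeoG i).Site), 0 < ε → ε < 1 → (kGeoG i).suppIn J y' →
        (kG i).e4 J y ≤ Cε ε * Real.exp (-(δ₃ * (kGeoG i).dist y y')) * ((kGeoG i).holder ε J + (kGeoG i).supNorm J) := by
  obtain ⟨σ₀, hσ₀, HK⟩ := ineq2138_kLevel_skeleton d ℓ hd hL hb₀ hb₁
  obtain ⟨σL, hσL, HL⟩ := hlegs
  have hσ : 0 < min σ₀ σL := lt_min hσ₀ hσL
  obtain ⟨M₂, hM₂, HK2⟩ := HK (min σ₀ σL) hσ (min_le_left _ _)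
  obtain ⟨ML, HL2⟩ := HL (min σ₀ σL) hσ (min_le_right _ _)
  refine ⟨max M₂ ML, min σ₀ σL / 8,
    fun ε => if h : 0 < ε ∧ ε < 1 then Classical.choose (HK2 ε h.1 h.2) * (1 + Classical.choose (HL2 ε h.1 h.2)) else 0,
    lt_max_of_lt_left hM₂, by positivity, ?_⟩
  intro i hM ε J y y' hε0 hε1 hJ
  obtain ⟨hA0, hmain⟩ := Classical.choose_spec (HK2 ε hε0 hε1)
  obtain ⟨hθ0, hleg⟩ := Classical.choose_spec (HL2 ε hε0 hε1)
  beta_reduce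
  rw [dif_pos ⟨hε0, hε1⟩]
  -- the thresholds of the index
  have hcast : (((ℓ + 1 : ℕ) : ℝ)) = (ℓ : ℝ) + 1 := by push_cast; ring
  have hM' : max M₂ ML ≤ ((ℓ : ℝ) + 1) * (i.Mh : ℝ) := by rw [← hcast]; exact hM
  have hM2 : M₂ ≤ ((ℓ : ℝ) + 1) * (i.Mh : ℝ) := (le_max_left _ _).trans hM'
  have hML : ML ≤ ((ℓ : ℝ) + 1) * (i.Mh : ℝ) := (le_max_right _ _).trans hM'
  -- the constant is nonnegative
  have hK0 : 0 ≤ Classical.choose (HK2 ε hε0 hε1) * (1 + Classical.choose (HL2 ε hε0 hε1)) *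
      Real.exp (-(min σ₀ σL / 8 * (kGeoG i).dist y y')) * ((kGeoG i).holder ε J + (kGeoG i).supNorm J) := by
    have h1 : 0 ≤ (kGeoG i).holder ε J := holderV1_nonneg i.hN i.D ε J
    have h2 : 0 ≤ (kGeoG i).supNorm J := supNormV1_nonneg J
    have h3 : 0 ≤ 1 + Classical.choose (HL2 ε hε0 hε1) := by linarith
    exact mul_nonneg (mul_nonneg (mul_nonneg hA0 h3) (Real.exp_nonneg _)) (add_nonneg h1 h2)
  -- the walk at the index, for every pair of directions
  have hT : ∀ ν μ : Fin (d + 1), HasMajorantA (g := geomT i.D) (blkV1 i.hN i.D)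
      (NormSupp (g := geomT i.D) (blkV1 i.hN i.D) (fun y' => ({y'} : Set (geomT i.D).Site)) (fun _ J => holderV1 i.hN i.D ε J + supNormV1 J))
      (DV (P := PV d ℓ i.m i.K hd hL) ν i.cf * onFun (GE (domT i.hN i.D i.hk) i.hcf i.hw) * DVa (P := PV d ℓ i.m i.K hd hL) μ i.cf)
      (fun y y' => Classical.choose (HK2 ε hε0 hε1) * (1 + Classical.choose (HL2 ε hε0 hε1)) *
        Real.exp (-(min σ₀ σL / 8 * (geomT i.D).dist y y'))) :=
    fun ν μ => hmain i.m i.K i.hN i.D i.hk i.hk2 i.hMha i.hM8 i.hR2 i.hP5 i.hℓ i.hpl hM2 i.hcf i.hw i.hwb ν μ _ hθ0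
      (fun c c' => hleg i.m i.K i.hN i.D i.hk i.hk2 i.hMha i.hM8 i.hR2 i.hP5 i.hℓ i.hpl hML i.hcf i.hw i.hwb μ c c')
  -- the census reading: sup over the two directions and over `x ∈ Δ(y)`
  refine Real.iSup_le (fun ν => Real.iSup_le (fun μ => supIn_le i hK0 fun x hx => ?_) hK0) hK0
  have e : (DV (P := PV d ℓ i.m i.K hd hL) ν i.cf ∘ₗ Gop i ∘ₗ DVa (P := PV d ℓ i.m i.K hd hL) μ i.cf) =
      DV (P := PV d ℓ i.m i.K hd hL) ν i.cf * onFun (GE (domT i.hN i.D i.hk) i.hcf i.hw) * DVa (P := PV d ℓ i.m i.K hd hL) μ i.cf := by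
    rw [Module.End.mul_eq_comp, Module.End.mul_eq_comp, LinearMap.comp_assoc]
  have h := abs_apply_le_of_suppIn i ε (hT ν μ) hJ x
  rw [hx, ← e] at h
  exact h

end Census

end

end Literature.MathematicalPhysics.QuantumFieldTheory.Balaban1983to89.B6Ineq2138KLevelSkeletonV1
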